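import Literature.NumberTheory.LFunctions.FujiiMeanSquare
import Literature.NumberTheory.LFunctions.ZeroPairSecondMomentProofs
import Literature.NumberTheory.LFunctions.AlternativeHypothesisConsequencesProofs
import HarnessLib

/-!
# GLSS 2026 (3.2) `glss2026_dsec2` DISCHARGED, and Theorems 2–4, Corollary 2 outright

LABEL (cell `rh-crit`, corpus C5 `ah`): **NOT RH-BEARING.** THEOREMS ONLY (no definition, no
named fact). bears_on: LADDER-RH §4 HELD «conditional bridges: exceptional zero ⇒ …». WHAT THIS
IS NOT: a claim about RH, AH or the pair correlation conjecture — GLSS's Theorems 2/3/4 and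
Corollary 2 keep THEIR hypotheses (AH-Pairs, (AH1), AH-Weak Density) inside their statements;
nothing here bears on the truth of RH.

Goldston–Lee–Schettler–Suriajaya (GLSS 2026, arXiv:2507.06823), §3 display (3.2) "(Dsec2)":
for every `λ > 0`, as `T → ∞`,
`𝒮(T, λ) − λ²T = (T/π²) log(2 + λ) + O(T √log(2 + λ)) + O(λ²T/L)` — the tree's named fact
`glss2026_dsec2` (`ZeroPairSecondMoment.lean`, rh-crit/ah G-ah-10). `ZeroPairSecondMomentProofs.lean`
proves it from Proposition 1 (Gallagher–Mueller, PROVED there), Proposition 2 (a) (PROVED there,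
`glss2026_proposition2a`) and Proposition 2 (b), the latter from Fujii's mean square
(Titchmarsh (9.25.2)) taken as the hypothesis `h252` in the printed range `0 ≤ h ≤ T/2`
(`glss2026_dsec2_of_fujii`). `FujiiMeanSquare.lean` now PROVES (9.25.2) unconditionally in the
range `0 ≤ h ≤ 1` (`fujii_meanSquare_asymptotic`; the printed range line "`0 ≤ h ≤ ½T`" over-claims,
rh-crit/ah erratum E-ah-6), and Proposition 2 (b) only ever uses `h = λ/L = 2πλ/log T ≤ 1/2`.
Hence:

* `glss2026_proposition2b` — GLSS Proposition 2, second display, OUTRIGHT: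
  `∫_0^T (S(t + λ/L) − S(t))² dt = (T/π²) log(2 + λ) + O(T √log(2 + λ))` (absolute constant,
  threshold depending on `λ`), by the bookkeeping of `glss2026_proposition2b_of_fujii` run on
  `fujii_meanSquare_asymptotic`.
* `glss2026_dsec2_of_prop2a_of_prop2b` — the assembly of `glss2026_dsec2_of_prop2a_of_fujii` with
  Proposition 2 (b) as a hypothesis in its OWN shape (instead of `h252`).
* **`glss2026_dsec2_holds : glss2026_dsec2`** — the named fact DISCHARGED (net debt −1).
* `glss2026_theorem2_holds`, `glss2026_theorem3_holds`, `glss2026_theorem4_holds`,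
  `glss2026_corollary2_holds` — GLSS Theorems 2, 3, 4 and Corollary 2 (named facts of
  `AlternativeHypothesisConsequences.lean`, reduced to (3.2) in
  `AlternativeHypothesisConsequencesProofs.lean`) DISCHARGED (net debt −4); their AH-type
  hypotheses (AH-Pairs, (AH1), AH-Weak Density) stay INSIDE their statements, as printed.

## References

* [GoldstonLeeSchettlerSuriajaya2026] D. A. Goldston, J. Lee, J. Schettler, A. I. Suriajaya,
  *Pair correlation conjecture for the zeros of the Riemann zeta-function II: the alternative
  hypothesis*, J. Number Theory 291 (2027), 49–64, arXiv:2507.06823, §3 Propositions 1–2,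
  eq. (3.2), Theorems 2–4, Corollary 2.
  [cite: GoldstonLeeSchettlerSuriajaya2026, §3 eq. (3.2)]
* [Titchmarsh1986] E. C. Titchmarsh, *The Theory of the Riemann Zeta-Function*, 2nd ed. rev.
  D. R. Heath-Brown (1986), §9.25 (9.25.2).
-/

noncomputable section

open MeasureTheory Filter
open scoped Real

namespace Literature.NumberTheory.LFunctions

/-! ### Proposition 2, second display, outright -/

/-- Numerics: `log(3 + 2πλ) ≤ 4 log(2 + λ)` for `λ > 0` (`3 + 2πλ ≤ (2 + λ)⁴`). [folklore] -/
private theorem log_three_add_two_pi_mul_le {lam : ℝ} (hlam : 0 < lam) :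
    Real.log (3 + 2 * π * lam) ≤ 4 * Real.log (2 + lam) := by
  have hπ : π < 4 := Real.pi_lt_four
  have hπ0 : 0 < π := Real.pi_pos
  have h1 : 3 + 2 * π * lam ≤ (2 + lam) ^ 4 := by nlinarith [sq_nonneg lam, sq_nonneg (lam + 2)]
  calc Real.log (3 + 2 * π * lam) ≤ Real.log ((2 + lam) ^ 4) :=
        Real.log_le_log (by positivity) h1
    _ = 4 * Real.log (2 + lam) := by rw [Real.log_pow]; norm_num

/-- **GLSS 2026, Proposition 2, second display, OUTRIGHT**: there is an absolute `A₁` such that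
for every `λ > 0`, for all large `T`,
`|∫_0^T (S(t + λ/L) − S(t))² dt − (T/π²) log(2 + λ)| ≤ A₁ T √log(2 + λ)` (`L = (log T)/2π`)
("`∫_0^T (S(t + λ/L) − S(t))² dt = (T/π²) log(2 + λ) + O(T√log(2 + λ))`", GLSS 2026 §3
Proposition 2, attributed to Gallagher–Mueller, Fujii, Tsang). Proof: Fujii's mean square
`fujii_meanSquare_asymptotic` (Titchmarsh (9.25.2), PROVED in `FujiiMeanSquare.lean` for
`0 ≤ h ≤ 1`) at `h = 2πλ/log T ≤ 1/2` (i.e. `log T ≥ 4πλ`), `h log T = 2πλ`, and the bookkeeping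
of `glss2026_proposition2b_of_fujii`: `0 ≤ log(3 + 2πλ) − log(2 + λ) ≤ log 2π < 2`,
`2/π² ≤ 6 log 2 ≤ 6 √log(2 + λ)`, `√log(3 + 2πλ) ≤ 2 √log(2 + λ)`; `A₁ = 2|A| + 6`.
[cite: GoldstonLeeSchettlerSuriajaya2026, §3 Proposition 2] -/
theorem glss2026_proposition2b :
    ∃ A₁ : ℝ, ∀ lam : ℝ, 0 < lam → ∀ᶠ T : ℝ in atTop,
      |(∫ t in (0 : ℝ)..T, (zetaArgS (t + lam / GLSS2026.L T) - zetaArgS t) ^ 2) -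
          T / π ^ 2 * Real.log (2 + lam)| ≤
        A₁ * (T * Real.sqrt (Real.log (2 + lam))) := by
  obtain ⟨A, T₀, hA⟩ := fujii_meanSquare_asymptotic
  refine ⟨2 * |A| + 6, fun lam hlam ↦ ?_⟩
  filter_upwards [eventually_ge_atTop T₀, eventually_ge_atTop (Real.exp (4 * π * lam)),
    eventually_ge_atTop (2 : ℝ)] with T hT0 hT1 hT2
  have hπ0 : 0 < π := Real.pi_pos
  have hπ3 : 3 < π := Real.pi_gt_three
  have hlogT : 4 * π * lam ≤ Real.log T := by
    rw [← Real.log_exp (4 * π * lam)]; exact Real.log_le_log (Real.exp_pos _) hT1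
  have hlog0 : 0 < Real.log T := by nlinarith
  have hL : GLSS2026.L T = Real.log T / (2 * π) := rfl
  -- h = 2πλ / log T
  have hh : lam / GLSS2026.L T = 2 * π * lam / Real.log T := by rw [hL]; field_simp
  have hh0 : 0 ≤ 2 * π * lam / Real.log T := by positivity
  have hh1 : 2 * π * lam / Real.log T ≤ 1 / 2 := by
    rw [div_le_iff₀ hlog0]; linarith
  have hh1' : 2 * π * lam / Real.log T ≤ 1 := hh1.trans (by norm_num)
  have hmain := hA T hT0 _ hh0 hh1'
  have e1 : 2 * π * lam / Real.log T * Real.log T = 2 * π * lam := by field_simp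
  rw [e1] at hmain
  rw [hh]
  -- compare the two main terms and the two square roots
  have hl2 : 0 < Real.log (2 + lam) := Real.log_pos (by linarith)
  have hl2' : Real.log 2 ≤ Real.log (2 + lam) := Real.log_le_log (by norm_num) (by linarith)
  have hlog2 : (0.6931471803 : ℝ) < Real.log 2 := Real.log_two_gt_d9
  have hs0 : 0 < Real.sqrt (Real.log (2 + lam)) := Real.sqrt_pos.mpr hl2
  have h4 := log_three_add_two_pi_mul_le hlam
  have hge : Real.log (2 + lam) ≤ Real.log (3 + 2 * π * lam) :=
    Real.log_le_log (by linarith) (by nlinarith)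
  -- √log(3+2πλ) ≤ 2 √log(2+λ)
  have hsqrt : Real.sqrt (Real.log (3 + 2 * π * lam)) ≤ 2 * Real.sqrt (Real.log (2 + lam)) := by
    rw [show (2 : ℝ) * Real.sqrt (Real.log (2 + lam)) = Real.sqrt (4 * Real.log (2 + lam)) by
      rw [Real.sqrt_mul (by norm_num), show Real.sqrt 4 = 2 by
        rw [show (4 : ℝ) = 2 ^ 2 by norm_num, Real.sqrt_sq (by norm_num)]]]
    exact Real.sqrt_le_sqrt h4
  -- main-term difference: log((3+2πλ)/(2+λ)) ≤ log 2π < 2, and 2/π² ≤ 6 log 2 ≤ 6 √log(2+λ)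
  have hratio : Real.log (3 + 2 * π * lam) - Real.log (2 + lam) ≤ 2 := by
    rw [← Real.log_div (by nlinarith) (by linarith)]
    have hq : (3 + 2 * π * lam) / (2 + lam) ≤ 2 * π := by
      rw [div_le_iff₀ (by linarith)]; nlinarith
    calc Real.log ((3 + 2 * π * lam) / (2 + lam)) ≤ Real.log (2 * π) :=
          Real.log_le_log (by positivity) hq
      _ ≤ 2 := (SelbergFujii.log_two_pi_lt_two).le
  have hsl : Real.log 2 ≤ Real.sqrt (Real.log (2 + lam)) := by
    -- log 2 ≤ √log 2 ≤ √log(2+λ)  (log 2 < 1)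
    have hlt1 : Real.log 2 < 1 := by
      have := Real.log_two_lt_d9; linarith
    calc Real.log 2 ≤ Real.sqrt (Real.log 2) := by
          conv_lhs => rw [← Real.sqrt_sq (by linarith : (0 : ℝ) ≤ Real.log 2)]
          exact Real.sqrt_le_sqrt (by nlinarith)
      _ ≤ Real.sqrt (Real.log (2 + lam)) := Real.sqrt_le_sqrt hl2'
  -- assemble
  have hT : 0 ≤ T := by linarith
  have hπ2 : 9 < π ^ 2 := by nlinarith
  have eM : (∫ t in (0 : ℝ)..T, (zetaArgS (t + 2 * π * lam / Real.log T) - zetaArgS t) ^ 2) -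
      T / π ^ 2 * Real.log (2 + lam) =
      ((∫ t in (0 : ℝ)..T, (zetaArgS (t + 2 * π * lam / Real.log T) - zetaArgS t) ^ 2) -
        T * Real.log (3 + 2 * π * lam) / π ^ 2) +
      T / π ^ 2 * (Real.log (3 + 2 * π * lam) - Real.log (2 + lam)) := by ring
  rw [eM]
  refine (abs_add_le _ _).trans ?_
  have hA' : |A| * (T * Real.sqrt (Real.log (3 + 2 * π * lam))) ≤
      2 * |A| * (T * Real.sqrt (Real.log (2 + lam))) := by
    have : T * Real.sqrt (Real.log (3 + 2 * π * lam)) ≤ T * (2 * Real.sqrt (Real.log (2 + lam))) :=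
      mul_le_mul_of_nonneg_left hsqrt hT
    nlinarith [abs_nonneg A]
  have h1 : |(∫ t in (0 : ℝ)..T, (zetaArgS (t + 2 * π * lam / Real.log T) - zetaArgS t) ^ 2) -
      T * Real.log (3 + 2 * π * lam) / π ^ 2| ≤ 2 * |A| * (T * Real.sqrt (Real.log (2 + lam))) := by
    refine hmain.trans (le_trans ?_ hA')
    exact mul_le_mul_of_nonneg_right (le_abs_self A) (by positivity)
  have h2 : |T / π ^ 2 * (Real.log (3 + 2 * π * lam) - Real.log (2 + lam))| ≤
      6 * (T * Real.sqrt (Real.log (2 + lam))) := by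
    rw [abs_of_nonneg (by
      have : 0 ≤ Real.log (3 + 2 * π * lam) - Real.log (2 + lam) := by linarith
      positivity)]
    -- T/π² · diff ≤ T/9 · 2 ≤ T · 6 · log 2 ≤ 6 T √log(2+λ)
    have hd0 : 0 ≤ Real.log (3 + 2 * π * lam) - Real.log (2 + lam) := by linarith
    have : T / π ^ 2 * (Real.log (3 + 2 * π * lam) - Real.log (2 + lam)) ≤ T / 9 * 2 := by
      have hπ2' : T / π ^ 2 ≤ T / 9 := div_le_div_of_nonneg_left hT (by norm_num) hπ2.le
      calc T / π ^ 2 * (Real.log (3 + 2 * π * lam) - Real.log (2 + lam))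
          ≤ T / 9 * (Real.log (3 + 2 * π * lam) - Real.log (2 + lam)) :=
            mul_le_mul_of_nonneg_right hπ2' hd0
        _ ≤ T / 9 * 2 := mul_le_mul_of_nonneg_left hratio (by positivity)
    nlinarith
  linarith

/-! ### Assembly: (3.2) from Proposition 1, Proposition 2 (a) and Proposition 2 (b) -/

/-- **GLSS 2026, (3.2) "(Dsec2)" assembled from its three inputs in THEIR OWN shapes**: the named
fact `glss2026_dsec2` follows from (P1) = `glss2026_proposition1` (PROVED in
`ZeroPairSecondMomentProofs.lean`), the first display of Proposition 2 in the weakened rendering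
`|∫_0^T (N(t+λ/L) − N(t))² − λ²T − ∫_0^T (S(t+λ/L) − S(t))²| ≤ A₂ (λ²T/L + T)` (hypothesis `h2a`;
PROVED as `glss2026_proposition2a`), and the second display of Proposition 2
`|∫_0^T (S(t+λ/L) − S(t))² − (T/π²) log(2+λ)| ≤ A₁ T √log(2+λ)` (hypothesis `h2b`; PROVED as
`glss2026_proposition2b`). This is the assembly `glss2026_dsec2_of_prop2a_of_fujii` verbatim, with
Proposition 2 (b) in place of Fujii's (9.25.2); constants `A₀ = |A₂| + (|A₂| + 2)·2 + |A₁|`.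
[cite: GoldstonLeeSchettlerSuriajaya2026, §3 eq. (3.2)] -/
theorem glss2026_dsec2_of_prop2a_of_prop2b
    (h2a : ∃ A₂ : ℝ, ∀ lam : ℝ, 0 < lam → ∀ᶠ T : ℝ in atTop,
      |(∫ t in (0 : ℝ)..T,
            ((zetaZeroCount (t + lam / GLSS2026.L T) : ℝ) - zetaZeroCount t) ^ 2) -
          lam ^ 2 * T -
          ∫ t in (0 : ℝ)..T, (zetaArgS (t + lam / GLSS2026.L T) - zetaArgS t) ^ 2| ≤
        A₂ * (lam ^ 2 * T / GLSS2026.L T + T))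
    (h2b : ∃ A₁ : ℝ, ∀ lam : ℝ, 0 < lam → ∀ᶠ T : ℝ in atTop,
      |(∫ t in (0 : ℝ)..T, (zetaArgS (t + lam / GLSS2026.L T) - zetaArgS t) ^ 2) -
          T / π ^ 2 * Real.log (2 + lam)| ≤
        A₁ * (T * Real.sqrt (Real.log (2 + lam)))) :
    glss2026_dsec2 := by
  obtain ⟨A₂, h2a⟩ := h2a
  obtain ⟨A₁, h2b⟩ := h2b
  -- A₂, A₁ ≥ 0 WLOG
  have hA₂ : ∀ lam : ℝ, 0 < lam → ∀ᶠ T : ℝ in atTop,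
      |(∫ t in (0 : ℝ)..T,
            ((zetaZeroCount (t + lam / GLSS2026.L T) : ℝ) - zetaZeroCount t) ^ 2) -
          lam ^ 2 * T -
          ∫ t in (0 : ℝ)..T, (zetaArgS (t + lam / GLSS2026.L T) - zetaArgS t) ^ 2| ≤
        |A₂| * (lam ^ 2 * T / GLSS2026.L T + T) := by
    intro lam hlam
    filter_upwards [h2a lam hlam, eventually_gt_atTop (1 : ℝ)] with T hT hT1
    refine hT.trans (mul_le_mul_of_nonneg_right (le_abs_self _) ?_)
    have := GLSS2026.L_pos hT1
    positivity
  refine ⟨|A₂| + (|A₂| + 2) * 2 + |A₁|, fun lam hlam ↦ ?_⟩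
  obtain ⟨C, hC⟩ := glss2026_proposition1 hlam
  -- `C log T ≤ T` eventually
  have hlogT : ∀ᶠ T : ℝ in atTop, |C| * Real.log T ≤ T := by
    have h := (Real.isLittleO_log_id_atTop.const_mul_left |C|).def zero_lt_one
    filter_upwards [h, eventually_gt_atTop (1 : ℝ)] with T hT hT1
    have hl : 0 ≤ Real.log T := Real.log_nonneg hT1.le
    have e1 : ‖|C| * Real.log T‖ = |C| * Real.log T := by
      rw [Real.norm_eq_abs, abs_of_nonneg (mul_nonneg (abs_nonneg C) hl)]
    have e2 : (1 : ℝ) * ‖id T‖ = T := by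
      rw [id, Real.norm_eq_abs, abs_of_pos (by linarith), one_mul]
    linarith [hT, e1, e2]
  filter_upwards [hC, hA₂ lam hlam, h2b lam hlam, eventually_gt_atTop (1 : ℝ), hlogT]
    with T h1 h2 h3 hT1 h4
  have hL : 0 < GLSS2026.L T := GLSS2026.L_pos hT1
  have hT0 : 0 < T := by linarith
  -- √log(2+λ) ≥ √log 2 ≥ 1/2
  have hs : 1 / 2 ≤ Real.sqrt (Real.log (2 + lam)) := by
    have hlog2 : (0.6931471803 : ℝ) < Real.log 2 := Real.log_two_gt_d9
    have h22 : Real.log 2 ≤ Real.log (2 + lam) := Real.log_le_log (by norm_num) (by linarith)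
    rw [show (1 : ℝ) / 2 = Real.sqrt (1 / 4) by
      rw [show (1 : ℝ) / 4 = (1 / 2) ^ 2 by norm_num, Real.sqrt_sq (by norm_num)]]
    exact Real.sqrt_le_sqrt (by linarith)
  have hs0 : 0 ≤ Real.sqrt (Real.log (2 + lam)) := Real.sqrt_nonneg _
  -- triangle inequality
  have h1' : |GLSS2026.secondMomentSum T lam -
      ∫ t in (0 : ℝ)..T,
        ((zetaZeroCount (t + lam / GLSS2026.L T) : ℝ) - zetaZeroCount t) ^ 2| ≤ T := by
    refine h1.trans (le_trans ?_ h4)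
    exact mul_le_mul_of_nonneg_right (le_abs_self C) (Real.log_nonneg hT1.le)
  have h3' : |(∫ t in (0 : ℝ)..T, (zetaArgS (t + lam / GLSS2026.L T) - zetaArgS t) ^ 2) -
      T / π ^ 2 * Real.log (2 + lam)| ≤ |A₁| * (T * Real.sqrt (Real.log (2 + lam))) :=
    h3.trans (mul_le_mul_of_nonneg_right (le_abs_self _) (by positivity))
  have key : |GLSS2026.secondMomentSum T lam - lam ^ 2 * T - T / π ^ 2 * Real.log (2 + lam)| ≤
      T + |A₂| * (lam ^ 2 * T / GLSS2026.L T + T) + |A₁| * (T * Real.sqrt (Real.log (2 + lam))) := by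
    have e : GLSS2026.secondMomentSum T lam - lam ^ 2 * T - T / π ^ 2 * Real.log (2 + lam) =
        (GLSS2026.secondMomentSum T lam -
          ∫ t in (0 : ℝ)..T,
            ((zetaZeroCount (t + lam / GLSS2026.L T) : ℝ) - zetaZeroCount t) ^ 2) +
        ((∫ t in (0 : ℝ)..T,
            ((zetaZeroCount (t + lam / GLSS2026.L T) : ℝ) - zetaZeroCount t) ^ 2) -
          lam ^ 2 * T -
          ∫ t in (0 : ℝ)..T, (zetaArgS (t + lam / GLSS2026.L T) - zetaArgS t) ^ 2) +
        ((∫ t in (0 : ℝ)..T, (zetaArgS (t + lam / GLSS2026.L T) - zetaArgS t) ^ 2) -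
          T / π ^ 2 * Real.log (2 + lam)) := by ring
    rw [e]
    exact (abs_add_three _ _ _).trans (add_le_add (add_le_add h1' h2) h3')
  refine key.trans ?_
  -- T ≤ 2 T √log(2+λ)
  have hT2 : T ≤ 2 * (T * Real.sqrt (Real.log (2 + lam))) := by nlinarith
  have hA2 : 0 ≤ |A₂| := abs_nonneg _
  have hA1 : 0 ≤ |A₁| := abs_nonneg _
  have hq : 0 ≤ lam ^ 2 * T / GLSS2026.L T := by positivity
  have hTs : 0 ≤ T * Real.sqrt (Real.log (2 + lam)) := by positivity
  nlinarith [mul_nonneg hA2 hTs, mul_nonneg hA2 hq]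

/-! ### The discharges -/

/-- **GLSS 2026, (3.2) "(Dsec2)" DISCHARGED**: `glss2026_dsec2` holds — for some absolute `A₀`,
for every `λ > 0`, for all large `T`,
`|𝒮(T, λ) − λ²T − (T/π²) log(2 + λ)| ≤ A₀ (T √log(2 + λ) + λ²T/L)`. Proof:
`glss2026_dsec2_of_prop2a_of_prop2b glss2026_proposition2a glss2026_proposition2b` — Proposition 1
(Gallagher–Mueller, exact window identity), Proposition 2 (a) (Riemann–von Mangoldt with the
`θ`-calculus and `sup|S| ≪ log t`), Proposition 2 (b) (Fujii's mean square, Titchmarsh (9.25.2) on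
`0 ≤ h ≤ 1`, from Selberg's mean-value approximate formula and zero-density theorem), all PROVED in
the tree. UNCONDITIONAL. [cite: GoldstonLeeSchettlerSuriajaya2026, §3 eq. (3.2)] -/
theorem glss2026_dsec2_holds : glss2026_dsec2 :=
  glss2026_dsec2_of_prop2a_of_prop2b glss2026_proposition2a glss2026_proposition2b

/-- **GLSS 2026, Theorem 2 DISCHARGED** ("Assuming AH-Pairs, for every sufficiently large even
integer `M` and `T → ∞`, `2 Σ_{j=1}^M (M − j)(P_{j−½}(T) + P_j(T) − (1 − 2/(π²(2j−1)²)))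
= (3/2 − P_0(T)) M − Σ_{j=1}^M P_{j−½}(T) + O(√log M) + O(M²(R(T) + 1/L²))`" — the AH-Pairs
witness datum stays quantified INSIDE the statement `glss2026_theorem2`, as typed):
`glss2026_theorem2_of_dsec2 glss2026_dsec2_holds`.
[cite: GoldstonLeeSchettlerSuriajaya2026, Theorem 2] -/
theorem glss2026_theorem2_holds : glss2026_theorem2 :=
  glss2026_theorem2_of_dsec2 glss2026_dsec2_holds

/-- **GLSS 2026, Theorem 3 DISCHARGED** ("Assuming AH-Pairs and (AH1), …" — both hypotheses
stay INSIDE the statement `glss2026_theorem3`, as typed):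
`glss2026_theorem3_of_dsec2 glss2026_dsec2_holds`. [cite: GoldstonLeeSchettlerSuriajaya2026, Theorem 3] -/
theorem glss2026_theorem3_holds : glss2026_theorem3 :=
  glss2026_theorem3_of_dsec2 glss2026_dsec2_holds

/-- **GLSS 2026, Theorem 4 DISCHARGED** ("Assuming AH-Pairs and AH-Weak Density, `p_0 = 1` and
asymptotically 100% of the zeros of `ζ(s)` are simple and on the critical line" — AH-Pairs and
AH-Weak Density stay the hypotheses INSIDE the statement `glss2026_theorem4`, as typed):
`glss2026_theorem4_of_dsec2 glss2026_dsec2_holds`. [cite: GoldstonLeeSchettlerSuriajaya2026, Theorem 4] -/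
theorem glss2026_theorem4_holds : glss2026_theorem4 :=
  glss2026_theorem4_of_dsec2 glss2026_dsec2_holds

/-- **GLSS 2026, Corollary 2 DISCHARGED** ("Assuming AH-Pairs and (AH1), `limsup P_0(T) ≤ 3/2`
and asymptotically at least 50% of the zeros of `ζ(s)` are simple and at least 50% are on the
critical line" — AH-Pairs and (AH1) stay the hypotheses INSIDE the statement `glss2026_corollary2`,
as typed): `glss2026_corollary2_of_dsec2 glss2026_dsec2_holds`.
[cite: GoldstonLeeSchettlerSuriajaya2026, Corollary 2] -/
theorem glss2026_corollary2_holds : glss2026_corollary2 :=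
  glss2026_corollary2_of_dsec2 glss2026_dsec2_holds

end Literature.NumberTheory.LFunctions

end
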